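import Literature.NumberTheory.LFunctions.WeilTwoPrimeOddMarginFBase
import Literature.NumberTheory.LFunctions.WeilTwoPrimeOddMarginFDataDn2
import Literature.NumberTheory.LFunctions.WeilBlockRowsPZ
import HarnessLib

/-!
# Two-prime odd-margin certificate F: the Bessel block claim `Hp = C H Cᵀ`, rows 70–74

`WeilCert.checkHpRow` for rows 70–74 of certificate F (the exact Legendre cancellation `C H Cᵀ = diag(2a₀/(4i+3))`), by `decide +kernel`. Pure proof file.
-/

noncomputable section

namespace Literature.NumberTheory.LFunctions

set_option maxHeartbeats 0 in
/-- Row 70 of `C H Cᵀ` is row 70 of `Hp` (certificate F). [folklore] -/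
theorem checkHpRow1_70_weilCert23F : weilCert23FBase.checkHpRow weilCert23FHp 1 70 = true := by
  decide +kernel

set_option maxHeartbeats 0 in
/-- Row 71 of `C H Cᵀ` is row 71 of `Hp` (certificate F). [folklore] -/
theorem checkHpRow1_71_weilCert23F : weilCert23FBase.checkHpRow weilCert23FHp 1 71 = true := by
  decide +kernel

set_option maxHeartbeats 0 in
/-- Row 72 of `C H Cᵀ` is row 72 of `Hp` (certificate F). [folklore] -/
theorem checkHpRow1_72_weilCert23F : weilCert23FBase.checkHpRow weilCert23FHp 1 72 = true := by
  decide +kernel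

set_option maxHeartbeats 0 in
/-- Row 73 of `C H Cᵀ` is row 73 of `Hp` (certificate F). [folklore] -/
theorem checkHpRow1_73_weilCert23F : weilCert23FBase.checkHpRow weilCert23FHp 1 73 = true := by
  decide +kernel

set_option maxHeartbeats 0 in
/-- Row 74 of `C H Cᵀ` is row 74 of `Hp` (certificate F). [folklore] -/
theorem checkHpRow1_74_weilCert23F : weilCert23FBase.checkHpRow weilCert23FHp 1 74 = true := by
  decide +kernel


end Literature.NumberTheory.LFunctions
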